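import Literature.NumberTheory.Sieve.QuadraticRootsPrimeModuliDFIBilinearPairs
import Literature.NumberTheory.Sieve.DivisorBound
import HarnessLib

/-!
# Duke–Friedlander–Iwaniec 1995, §5: Proposition 2 from Proposition 4

Topic `Literature/NumberTheory/Sieve`.  Ninth file of the deduction of DFI's Propositions 1–2 from
Proposition 4 (W. Duke, J. B. Friedlander, H. Iwaniec, Ann. of Math. 141 (1995), §5
pp. 432–433), assembling `QuadraticRootsPrimeModuliDFI{Smoothing,RhoSums,BilinearCRT,BilinearFibre,
BilinearCauchy,BilinearOffDiag,BilinearPairs}.lean` into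

* `dukeFriedlanderIwaniec1995_proposition2_of_proposition4 :
    dukeFriedlanderIwaniec1995_proposition4 → dukeFriedlanderIwaniec1995_proposition2`.

The argument is the printed one (§5): Cauchy in `(m, δ)` with the weight `‖αρ‖`, a smooth
majorant of `(M, 2M]` (here: four plateaux at the scales `M'_k = (3/4)M(5/4)^k`, so that (25)
applies at each scale), the diagonal `n₁ = n₂` by the trivial bound `≪ M`, the off-diagonal by
the CRT identity, removal of `(m, n₁n₂) = 1` at the cost `≪ M/N`, and (25) with `d = n₁n₂`,
`h ↦ (n₂ − n₁)h` in the range `N² ≪ M`; "the proposition is otherwise trivial".  Two points the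
paper leaves implicit are made explicit: the factor `(h(n₂ − n₁), n₁n₂)^{1/4} = (h,n₁)^{1/4}(h,n₂)^{1/4}`
of (25) is summed over `n₁, n₂` using `∑_{N<p≤2N} (h,p)^{1/2} ≤ 2N + 2√(2N) log h`
(`DFI1995.sum_sqrt_gcd_primes_le`), and `τ(h(n₂−n₁)n₁n₂)^{3/2} log(2M')(1 + log h) ≪ M^{2ε}` uses
`h ≤ C₂MN`, `N² < M/2` and the divisor bound; the constant therefore depends on `f, ε, C₂` only,
as in the vendored statement. [cite: DukeFriedlanderIwaniec1995, Proposition 2 p. 426 (10); proof §5 pp. 432–433]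

No new named fact is introduced (D-0026); Proposition 4 enters as a hypothesis.

## References

* W. Duke, J. B. Friedlander, H. Iwaniec, Ann. of Math. (2) 141 (1995), 423–441: Proposition 2
  (p. 426, (10)), §5 (pp. 432–433). [cite: DukeFriedlanderIwaniec1995, Proposition 2 and §5]
-/

noncomputable section

namespace Literature.NumberTheory.Sieve

open scoped BigOperators Polynomial ComplexConjugate
open Finset Polynomial

namespace DFI1995

/-! ### Summing over `n₁, n₂` -/

/-- **"Summing over all `n₁, n₂`"** (p. 433): if `V(n, n) ≤ D` on the support of `b ≥ 0` and
`V(n₁, n₂) ≤ E₀ w_{n₁} w_{n₂} + E₁` for `n₁ ≠ n₂` in the support, then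
`∑∑ b_{n₁} b_{n₂} V(n₁, n₂) ≤ D ∑ b² + E₀ (∑ b w)² + E₁ (∑ b)²`. [folklore] -/
theorem sum_sum_pairs_le (S : Finset ℕ) (b w : ℕ → ℝ) (V : ℕ → ℕ → ℝ) {D E₀ E₁ : ℝ}
    (hb : ∀ n, 0 ≤ b n) (hw : ∀ n, 0 ≤ w n) (hE₀ : 0 ≤ E₀) (hE₁ : 0 ≤ E₁)
    (hdiag : ∀ n ∈ S, b n ≠ 0 → V n n ≤ D)
    (hoff : ∀ n₁ ∈ S, ∀ n₂ ∈ S, b n₁ ≠ 0 → b n₂ ≠ 0 → n₁ ≠ n₂ → V n₁ n₂ ≤ E₀ * w n₁ * w n₂ + E₁) :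
    ∑ n₁ ∈ S, ∑ n₂ ∈ S, b n₁ * b n₂ * V n₁ n₂ ≤
      D * ∑ n ∈ S, b n ^ 2 + E₀ * (∑ n ∈ S, b n * w n) ^ 2 + E₁ * (∑ n ∈ S, b n) ^ 2 := by
  classical
  have hterm : ∀ n₁ ∈ S, ∀ n₂ ∈ S, b n₁ * b n₂ * V n₁ n₂ ≤
      b n₁ * b n₂ * ((if n₁ = n₂ then D else 0) + E₀ * w n₁ * w n₂ + E₁) := by
    intro n₁ h₁ n₂ h₂
    by_cases hb0 : b n₁ * b n₂ = 0
    · rw [hb0, zero_mul, zero_mul]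
    have hb1 : b n₁ ≠ 0 := fun h => hb0 (by rw [h, zero_mul])
    have hb2 : b n₂ ≠ 0 := fun h => hb0 (by rw [h, mul_zero])
    refine mul_le_mul_of_nonneg_left ?_ (mul_nonneg (hb _) (hb _))
    by_cases heq : n₁ = n₂
    · subst heq
      rw [if_pos rfl]
      have := hdiag n₁ h₁ hb1
      nlinarith [hw n₁, mul_nonneg hE₀ (mul_nonneg (hw n₁) (hw n₁))]
    · rw [if_neg heq, zero_add]
      exact hoff n₁ h₁ n₂ h₂ hb1 hb2 heq
  calc ∑ n₁ ∈ S, ∑ n₂ ∈ S, b n₁ * b n₂ * V n₁ n₂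
      ≤ ∑ n₁ ∈ S, ∑ n₂ ∈ S, b n₁ * b n₂ * ((if n₁ = n₂ then D else 0) + E₀ * w n₁ * w n₂ + E₁) :=
        Finset.sum_le_sum fun n₁ h₁ => Finset.sum_le_sum fun n₂ h₂ => hterm n₁ h₁ n₂ h₂
    _ = D * ∑ n ∈ S, b n ^ 2 + E₀ * (∑ n ∈ S, b n * w n) ^ 2 + E₁ * (∑ n ∈ S, b n) ^ 2 := by
        have h1 : ∑ n₁ ∈ S, ∑ n₂ ∈ S, b n₁ * b n₂ * (if n₁ = n₂ then D else 0) = D * ∑ n ∈ S, b n ^ 2 := by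
          rw [Finset.mul_sum]
          refine Finset.sum_congr rfl fun n₁ h₁ => ?_
          simp_rw [mul_ite, mul_zero]
          rw [Finset.sum_ite_eq S n₁, if_pos h₁]
          ring
        have h2 : ∑ n₁ ∈ S, ∑ n₂ ∈ S, b n₁ * b n₂ * (E₀ * w n₁ * w n₂) = E₀ * (∑ n ∈ S, b n * w n) ^ 2 := by
          rw [sq, Finset.sum_mul_sum, Finset.mul_sum]
          refine Finset.sum_congr rfl fun n₁ _ => ?_
          rw [Finset.mul_sum]
          refine Finset.sum_congr rfl fun n₂ _ => ?_
          ring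
        have h3 : ∑ n₁ ∈ S, ∑ n₂ ∈ S, b n₁ * b n₂ * E₁ = E₁ * (∑ n ∈ S, b n) ^ 2 := by
          rw [sq, Finset.sum_mul_sum, Finset.mul_sum]
          refine Finset.sum_congr rfl fun n₁ _ => ?_
          rw [Finset.mul_sum]
          refine Finset.sum_congr rfl fun n₂ _ => ?_
          ring
        rw [← h1, ← h2, ← h3, ← Finset.sum_add_distrib, ← Finset.sum_add_distrib]
        refine Finset.sum_congr rfl fun n₁ _ => ?_
        rw [← Finset.sum_add_distrib, ← Finset.sum_add_distrib]
        refine Finset.sum_congr rfl fun n₂ _ => ?_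
        ring

/-! ### The diagonal and off-diagonal pair bounds with the cover weight -/

/-- The diagonal pairs: `V(n, n) ≤ 6 C_diag M` for `n` prime (`M ≥ 2`). [cite: DukeFriedlanderIwaniec1995, §5 p. 433] -/
theorem norm_cover_diag_le {f : ℤ[X]} {Cd : ℝ}
    (hCd : ∀ (g : ℝ → ℝ) (M' X : ℝ), 0 ≤ M' → 2 * M' ≤ X → (∀ t : ℝ, |g t| ≤ 1) →
      (∀ t : ℝ, g t ≠ 0 → M' ≤ t ∧ t ≤ 2 * M') → ∀ (h : ℤ) (n : ℕ), n.Prime →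
      ‖∑ m ∈ (Icc 1 ⌊X⌋₊).filter (fun m => Nat.Coprime m n ∧ Nat.Coprime m n),
        (g m : ℂ) * fibrePairSum f h m n n‖ ≤ Cd * M')
    {M : ℝ} (hM : 2 ≤ M) (h : ℤ) {n : ℕ} (hn : n.Prime) :
    ‖∑ m ∈ (Icc 1 ⌊3 * M⌋₊).filter (fun m => Nat.Coprime m n ∧ Nat.Coprime m n),
      (coverWeight M m : ℂ) * fibrePairSum f h m n n‖ ≤ 6 * Cd * M := by
  have hM0 : 0 < M := by linarith
  refine (norm_sum_coverWeight_le M _ _).trans ?_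
  have hk : ∀ k ∈ Finset.range 4, ‖∑ m ∈ (Icc 1 ⌊3 * M⌋₊).filter (fun m => Nat.Coprime m n ∧ Nat.Coprime m n),
      (pieceWeight M k m : ℂ) * fibrePairSum f h m n n‖ ≤ Cd * (3 / 2 * M) := by
    intro k hk
    rw [Finset.mem_range] at hk
    obtain ⟨h1, h2, h3, h4⟩ := pieceScale_bounds hM hk
    have := hCd (pieceWeight M k) (3 / 4 * piecePt M k) (3 * M) (by linarith) h2
      (fun t => by
        obtain ⟨a1, a2⟩ := pieceWeight_mem hM0 k t
        rw [abs_of_nonneg a1]; exact a2)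
      (fun t ht => pieceWeight_ne_zero hM0 k ht) h n hn
    refine this.trans ?_
    have hCd0 : 0 ≤ Cd := by
      have h0 := hCd (fun _ => 0) 1 2 zero_le_one (by norm_num) (fun t => by simp) (fun t ht => absurd rfl ht) h n hn
      simp at h0
      linarith
    exact mul_le_mul_of_nonneg_left h4 hCd0
  refine (Finset.sum_le_sum hk).trans ?_
  rw [Finset.sum_const, Finset.card_range, nsmul_eq_mul]
  norm_num
  nlinarith

/-- `|n₂ − n₁| < n₁`, `< n₂` and `≤ N` for `n₁, n₂ ∈ (N, 2N]`. [folklore] -/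
theorem natAbs_sub_lt_of_mem {n₁ n₂ : ℕ} {N : ℝ} (h1 : N < n₁) (h1' : (n₁ : ℝ) ≤ 2 * N)
    (h2 : N < n₂) (h2' : (n₂ : ℝ) ≤ 2 * N) :
    Int.natAbs ((n₂ : ℤ) - n₁) < n₁ ∧ Int.natAbs ((n₂ : ℤ) - n₁) < n₂ ∧
      (Int.natAbs ((n₂ : ℤ) - n₁) : ℝ) ≤ N := by
  have key : ((Int.natAbs ((n₂ : ℤ) - n₁) : ℕ) : ℝ) < N ∧ (N : ℝ) < n₁ ∧ (N : ℝ) < n₂ := by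
    refine ⟨?_, h1, h2⟩
    have e : ((Int.natAbs ((n₂ : ℤ) - n₁) : ℕ) : ℝ) = |(n₂ : ℝ) - n₁| := by
      have : (((Int.natAbs ((n₂ : ℤ) - n₁) : ℕ) : ℤ) : ℝ) = |(n₂ : ℝ) - n₁| := by
        rw [Int.natCast_natAbs, Int.cast_abs, Int.cast_sub, Int.cast_natCast, Int.cast_natCast]
      rw [← this, Int.cast_natCast]
    rw [e, abs_lt]; constructor <;> linarith
  refine ⟨by exact_mod_cast key.1.trans key.2.1, by exact_mod_cast key.1.trans key.2.2, key.1.le⟩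

/-- `(h |n₂ − n₁|, n₁ n₂) = (h, n₁)(h, n₂)` for distinct primes `n₁, n₂ ∈ (N, 2N]`. [folklore] -/
theorem gcd_freq_eq {h n₁ n₂ : ℕ} (hp₁ : n₁.Prime) (hp₂ : n₂.Prime) (hne : n₁ ≠ n₂)
    (ht₁ : Int.natAbs ((n₂ : ℤ) - n₁) < n₁) (ht₂ : Int.natAbs ((n₂ : ℤ) - n₁) < n₂) :
    Nat.gcd (h * Int.natAbs ((n₂ : ℤ) - n₁)) (n₁ * n₂) = Nat.gcd h n₁ * Nat.gcd h n₂ := by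
  set t := Int.natAbs ((n₂ : ℤ) - n₁) with ht
  have ht0 : 0 < t := by
    rw [ht, Int.natAbs_pos, sub_ne_zero]
    exact_mod_cast hne.symm
  have hcop : Nat.Coprime t (n₁ * n₂) := by
    apply Nat.Coprime.mul_right
    · exact (Nat.coprime_comm.1 ((Nat.Prime.coprime_iff_not_dvd hp₁).2 (Nat.not_dvd_of_pos_of_lt ht0 ht₁)))
    · exact (Nat.coprime_comm.1 ((Nat.Prime.coprime_iff_not_dvd hp₂).2 (Nat.not_dvd_of_pos_of_lt ht0 ht₂)))
  rw [Nat.Coprime.gcd_mul_right_cancel h hcop]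
  exact Nat.Coprime.gcd_mul h ((Nat.coprime_primes hp₁ hp₂).2 hne)

/-- The off-diagonal pairs in the range `2N² < M`: with the constant `K` of
`exists_norm_offdiag_weight_le` (for `C₁ = 6`, `C₂' = 2C₂`) and the absolute `B`,
`V(n₁, n₂) ≤ 648 B K (τ(h''d)^{3/2} (h,n₁)^{1/4} (h,n₂)^{1/4} · 3 N^{1/2} M^{3/4} log(3M) + 3M/N)`.
[cite: DukeFriedlanderIwaniec1995, §5 p. 433] -/
theorem norm_cover_offdiag_le {f : ℤ[X]} {K C₂ B : ℝ} (hB1 : 1 ≤ B)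
    (hB : ∀ n : ℕ, n ≤ 4 → ∀ x : ℝ, |iteratedDeriv n Real.smoothTransition x| ≤ B)
    (hK : ∀ (g : ℝ → ℝ) (M' X : ℝ), 1 ≤ M' → 2 * M' ≤ X → ContDiff ℝ 4 g →
      (∀ t : ℝ, g t ≠ 0 → M' ≤ t ∧ t ≤ 2 * M') →
      (∀ j : ℕ, j ≤ 4 → ∀ t : ℝ, |iteratedDeriv j g t| ≤ M' ^ (-(j : ℝ))) →
      ∀ h : ℕ, 1 ≤ h → ∀ n₁ n₂ : ℕ, n₁.Prime → n₂.Prime → n₁ ≠ n₂ →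
      ((n₁ * n₂ : ℕ) : ℝ) ≤ 6 * M' →
      ((h * Int.natAbs ((n₂ : ℤ) - n₁) : ℕ) : ℝ) ≤ (2 * C₂) * ((n₁ * n₂ : ℕ) : ℝ) * M' →
      ‖∑ m ∈ (Icc 1 ⌊X⌋₊).filter (fun m => Nat.Coprime m n₁ ∧ Nat.Coprime m n₂),
        (g m : ℂ) * fibrePairSum f h m n₁ n₂‖ ≤
        K * (((Nat.divisors (h * Int.natAbs ((n₂ : ℤ) - n₁) * (n₁ * n₂))).card : ℝ) ^ (3 / 2 : ℝ) *
              (Nat.gcd (h * Int.natAbs ((n₂ : ℤ) - n₁)) (n₁ * n₂) : ℝ) ^ (1 / 4 : ℝ) *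
              ((n₁ * n₂ : ℕ) : ℝ) ^ (1 / 4 : ℝ) * M' ^ (3 / 4 : ℝ) * Real.log (2 * M') +
            M' / n₁ + M' / n₂))
    (hK0 : 0 ≤ K) (hC₂ : 0 < C₂) {M N : ℝ} (hN : 1 ≤ N) (hMN : 2 * N ^ 2 < M)
    {h : ℕ} (hh : 1 ≤ h) (hhMN : (h : ℝ) ≤ C₂ * M * N)
    {n₁ n₂ : ℕ} (hp₁ : n₁.Prime) (hp₂ : n₂.Prime) (hne : n₁ ≠ n₂)
    (hn₁ : N < n₁ ∧ (n₁ : ℝ) ≤ 2 * N) (hn₂ : N < n₂ ∧ (n₂ : ℝ) ≤ 2 * N) :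
    ‖∑ m ∈ (Icc 1 ⌊3 * M⌋₊).filter (fun m => Nat.Coprime m n₁ ∧ Nat.Coprime m n₂),
      (coverWeight M m : ℂ) * fibrePairSum f h m n₁ n₂‖ ≤
      648 * B * K * ((((Nat.divisors (h * Int.natAbs ((n₂ : ℤ) - n₁) * (n₁ * n₂))).card : ℝ) ^ (3 / 2 : ℝ)) *
        ((Nat.gcd h n₁ : ℝ) ^ (1 / 4 : ℝ) * (Nat.gcd h n₂ : ℝ) ^ (1 / 4 : ℝ)) *
        (3 * N ^ (1 / 2 : ℝ) * M ^ (3 / 4 : ℝ) * Real.log (3 * M)) + 3 * M / N) := by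
  have hM2 : 2 ≤ M := by nlinarith
  have hM0 : 0 < M := by linarith
  have hN0 : 0 < N := by linarith
  obtain ⟨ht₁, ht₂, htN⟩ := natAbs_sub_lt_of_mem hn₁.1 hn₁.2 hn₂.1 hn₂.2
  have hd4 : ((n₁ * n₂ : ℕ) : ℝ) ≤ 4 * N ^ 2 := by push_cast; nlinarith [hn₁.1, hn₂.1]
  have hdN : N ^ 2 ≤ ((n₁ * n₂ : ℕ) : ℝ) := by push_cast; nlinarith [hn₁.1, hn₂.1]
  -- the frequency
  have hfreqN : ((h * Int.natAbs ((n₂ : ℤ) - n₁) : ℕ) : ℝ) ≤ C₂ * M * N ^ 2 := by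
    push_cast
    calc (h : ℝ) * (Int.natAbs ((n₂ : ℤ) - n₁) : ℕ) ≤ (C₂ * M * N) * N :=
          mul_le_mul hhMN htN (Nat.cast_nonneg _) (by positivity)
      _ = C₂ * M * N ^ 2 := by ring
  refine (norm_sum_coverWeight_le M _ _).trans ?_
  -- each piece
  have hk : ∀ k ∈ Finset.range 4, ‖∑ m ∈ (Icc 1 ⌊3 * M⌋₊).filter (fun m => Nat.Coprime m n₁ ∧ Nat.Coprime m n₂),
      (pieceWeight M k m : ℂ) * fibrePairSum f h m n₁ n₂‖ ≤
      162 * B * K * ((((Nat.divisors (h * Int.natAbs ((n₂ : ℤ) - n₁) * (n₁ * n₂))).card : ℝ) ^ (3 / 2 : ℝ)) *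
        ((Nat.gcd h n₁ : ℝ) ^ (1 / 4 : ℝ) * (Nat.gcd h n₂ : ℝ) ^ (1 / 4 : ℝ)) *
        (3 * N ^ (1 / 2 : ℝ) * M ^ (3 / 4 : ℝ) * Real.log (3 * M)) + 3 * M / N) := by
    intro k hk
    rw [Finset.mem_range] at hk
    obtain ⟨h1, h2, h3, h4⟩ := pieceScale_bounds hM2 hk
    set M' : ℝ := 3 / 4 * piecePt M k with hM'
    have hM'0 : 0 < M' := by linarith
    -- the normalised weight
    set g : ℝ → ℝ := fun s => pieceWeight M k s / (162 * B) with hg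
    have hBpos : 0 < 162 * B := by linarith
    have hBc : (B : ℂ) ≠ 0 := Complex.ofReal_ne_zero.2 (by linarith)
    have hpw : ∀ m : ℕ, (pieceWeight M k m : ℂ) = (162 * B : ℂ) * (g m : ℂ) := by
      intro m
      simp only [hg]
      push_cast
      field_simp
    have hsum : ∑ m ∈ (Icc 1 ⌊3 * M⌋₊).filter (fun m => Nat.Coprime m n₁ ∧ Nat.Coprime m n₂),
        (pieceWeight M k m : ℂ) * fibrePairSum f h m n₁ n₂ =
        (162 * B : ℂ) * ∑ m ∈ (Icc 1 ⌊3 * M⌋₊).filter (fun m => Nat.Coprime m n₁ ∧ Nat.Coprime m n₂),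
          (g m : ℂ) * fibrePairSum f h m n₁ n₂ := by
      rw [Finset.mul_sum]
      refine Finset.sum_congr rfl fun m _ => ?_
      rw [hpw m, mul_assoc]
    rw [hsum, norm_mul, show ‖(162 * B : ℂ)‖ = 162 * B by
      rw [show (162 * B : ℂ) = ((162 * B : ℝ) : ℂ) by push_cast; ring, Complex.norm_real,
        Real.norm_eq_abs, abs_of_pos hBpos]]
    have hgK := hK g M' (3 * M) h1 h2
      ((contDiff_pieceWeight M k).div_const _)
      (fun t ht => by
        have : pieceWeight M k t ≠ 0 := fun h0 => ht (by simp [hg, h0])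
        exact pieceWeight_ne_zero hM0 k this)
      (fun j hj t => abs_iteratedDeriv_pieceWeight_div_le hB1 hB hM0 k hj t)
      h hh n₁ n₂ hp₁ hp₂ hne (by linarith) (hfreqN.trans (by
        have a1 : N ^ 2 * (3 / 4 * M) ≤ ((n₁ * n₂ : ℕ) : ℝ) * M' :=
          mul_le_mul hdN h3 (by positivity) (Nat.cast_nonneg _)
        have a2 : 0 ≤ ((n₁ * n₂ : ℕ) : ℝ) * M' := by positivity
        nlinarith [a1, a2, hC₂.le]))
    rw [mul_assoc (162 * B) K]
    refine mul_le_mul_of_nonneg_left (hgK.trans (mul_le_mul_of_nonneg_left ?_ hK0)) hBpos.le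
    -- simplify the shape
    rw [gcd_freq_eq hp₁ hp₂ hne ht₁ ht₂]
    have hτ0 : 0 ≤ (((Nat.divisors (h * Int.natAbs ((n₂ : ℤ) - n₁) * (n₁ * n₂))).card : ℝ) ^ (3 / 2 : ℝ)) := by
      positivity
    have hγ : ((Nat.gcd h n₁ * Nat.gcd h n₂ : ℕ) : ℝ) ^ (1 / 4 : ℝ) =
        (Nat.gcd h n₁ : ℝ) ^ (1 / 4 : ℝ) * (Nat.gcd h n₂ : ℝ) ^ (1 / 4 : ℝ) := by
      push_cast
      exact Real.mul_rpow (Nat.cast_nonneg _) (Nat.cast_nonneg _)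
    have hd14 : ((n₁ * n₂ : ℕ) : ℝ) ^ (1 / 4 : ℝ) ≤ 2 * N ^ (1 / 2 : ℝ) := by
      calc ((n₁ * n₂ : ℕ) : ℝ) ^ (1 / 4 : ℝ) ≤ (4 * N ^ 2) ^ (1 / 4 : ℝ) :=
            Real.rpow_le_rpow (Nat.cast_nonneg _) hd4 (by norm_num)
        _ = (4 : ℝ) ^ (1 / 4 : ℝ) * N ^ (1 / 2 : ℝ) := by
            rw [Real.mul_rpow (by norm_num) (by positivity), show (N ^ 2 : ℝ) = N ^ (2 : ℝ) by norm_cast,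
              ← Real.rpow_mul hN0.le]
            norm_num
        _ ≤ 2 * N ^ (1 / 2 : ℝ) := by
            refine mul_le_mul_of_nonneg_right ?_ (by positivity)
            have : (4 : ℝ) ^ (1 / 4 : ℝ) ≤ (4 : ℝ) ^ (1 / 2 : ℝ) :=
              Real.rpow_le_rpow_of_exponent_le (by norm_num) (by norm_num)
            have h4 : (4 : ℝ) ^ (1 / 2 : ℝ) = 2 := by
              rw [show (4 : ℝ) = 2 ^ (2 : ℝ) by norm_num, ← Real.rpow_mul (by norm_num)]; norm_num
            linarith
    have hM34 : M' ^ (3 / 4 : ℝ) ≤ 3 / 2 * M ^ (3 / 4 : ℝ) := by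
      calc M' ^ (3 / 4 : ℝ) ≤ (3 / 2 * M) ^ (3 / 4 : ℝ) := Real.rpow_le_rpow hM'0.le h4 (by norm_num)
        _ = (3 / 2 : ℝ) ^ (3 / 4 : ℝ) * M ^ (3 / 4 : ℝ) := Real.mul_rpow (by norm_num) hM0.le
        _ ≤ 3 / 2 * M ^ (3 / 4 : ℝ) := by
            refine mul_le_mul_of_nonneg_right ?_ (by positivity)
            calc (3 / 2 : ℝ) ^ (3 / 4 : ℝ) ≤ (3 / 2 : ℝ) ^ (1 : ℝ) :=
                  Real.rpow_le_rpow_of_exponent_le (by norm_num) (by norm_num)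
              _ = 3 / 2 := Real.rpow_one _
    have hlog : Real.log (2 * M') ≤ Real.log (3 * M) := Real.log_le_log (by positivity) h2
    have hlog0 : 0 ≤ Real.log (2 * M') := Real.log_nonneg (by linarith)
    have hfrac : M' / n₁ + M' / n₂ ≤ 3 * M / N := by
      have e1 : M' / n₁ ≤ (3 / 2 * M) / N := by
        rw [div_le_div_iff₀ (by exact_mod_cast hp₁.pos) hN0]
        calc M' * N ≤ (3 / 2 * M) * N := mul_le_mul_of_nonneg_right h4 hN0.le
          _ ≤ (3 / 2 * M) * n₁ := mul_le_mul_of_nonneg_left hn₁.1.le (by positivity)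
      have e2 : M' / n₂ ≤ (3 / 2 * M) / N := by
        rw [div_le_div_iff₀ (by exact_mod_cast hp₂.pos) hN0]
        calc M' * N ≤ (3 / 2 * M) * N := mul_le_mul_of_nonneg_right h4 hN0.le
          _ ≤ (3 / 2 * M) * n₂ := mul_le_mul_of_nonneg_left hn₂.1.le (by positivity)
      calc M' / n₁ + M' / n₂ ≤ (3 / 2 * M) / N + (3 / 2 * M) / N := add_le_add e1 e2
        _ = 3 * M / N := by ring
    rw [hγ]
    have hgg : 0 ≤ (Nat.gcd h n₁ : ℝ) ^ (1 / 4 : ℝ) * (Nat.gcd h n₂ : ℝ) ^ (1 / 4 : ℝ) := by positivity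
    calc (((Nat.divisors (h * Int.natAbs ((n₂ : ℤ) - n₁) * (n₁ * n₂))).card : ℝ) ^ (3 / 2 : ℝ)) *
          ((Nat.gcd h n₁ : ℝ) ^ (1 / 4 : ℝ) * (Nat.gcd h n₂ : ℝ) ^ (1 / 4 : ℝ)) *
          ((n₁ * n₂ : ℕ) : ℝ) ^ (1 / 4 : ℝ) * M' ^ (3 / 4 : ℝ) * Real.log (2 * M') + M' / n₁ + M' / n₂
        = (((Nat.divisors (h * Int.natAbs ((n₂ : ℤ) - n₁) * (n₁ * n₂))).card : ℝ) ^ (3 / 2 : ℝ)) *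
          ((Nat.gcd h n₁ : ℝ) ^ (1 / 4 : ℝ) * (Nat.gcd h n₂ : ℝ) ^ (1 / 4 : ℝ)) *
          (((n₁ * n₂ : ℕ) : ℝ) ^ (1 / 4 : ℝ) * M' ^ (3 / 4 : ℝ) * Real.log (2 * M')) + (M' / n₁ + M' / n₂) := by ring
      _ ≤ (((Nat.divisors (h * Int.natAbs ((n₂ : ℤ) - n₁) * (n₁ * n₂))).card : ℝ) ^ (3 / 2 : ℝ)) *
          ((Nat.gcd h n₁ : ℝ) ^ (1 / 4 : ℝ) * (Nat.gcd h n₂ : ℝ) ^ (1 / 4 : ℝ)) *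
          ((2 * N ^ (1 / 2 : ℝ)) * (3 / 2 * M ^ (3 / 4 : ℝ)) * Real.log (3 * M)) + 3 * M / N := by
          gcongr
      _ = _ := by ring
  refine (Finset.sum_le_sum hk).trans ?_
  rw [Finset.sum_const, Finset.card_range, nsmul_eq_mul]
  exact le_of_eq (by push_cast; ring)

/-! ### Real-variable bookkeeping -/

/-- `√(x + y) ≤ √x + √y`. [folklore] -/
theorem sqrt_add_le' {x y : ℝ} (hx : 0 ≤ x) (hy : 0 ≤ y) : Real.sqrt (x + y) ≤ Real.sqrt x + Real.sqrt y := by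
  rw [Real.sqrt_le_iff]
  refine ⟨by positivity, ?_⟩
  nlinarith [Real.sq_sqrt hx, Real.sq_sqrt hy, Real.sqrt_nonneg x, Real.sqrt_nonneg y]

/-- The final square root: `√(A₁ M + A₂ N^{3/2} M^{3/4+2ε}) ≤ √A₁ M^{1/2} + √A₂ N^{3/4} M^{3/8+ε}`.
[folklore] -/
theorem sqrt_main_le {A₁ A₂ M N ε : ℝ} (hA₁ : 0 ≤ A₁) (hA₂ : 0 ≤ A₂) (hM : 0 < M) (hN : 0 < N) :
    Real.sqrt (A₁ * M + A₂ * N ^ (3 / 2 : ℝ) * M ^ (3 / 4 + 2 * ε)) ≤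
      Real.sqrt A₁ * M ^ (1 / 2 : ℝ) + Real.sqrt A₂ * N ^ (3 / 4 : ℝ) * M ^ (3 / 8 + ε) := by
  refine (sqrt_add_le' (by positivity) (by positivity)).trans (le_of_eq ?_)
  have e1 : Real.sqrt (A₁ * M) = Real.sqrt A₁ * M ^ (1 / 2 : ℝ) := by
    rw [Real.sqrt_mul hA₁, Real.sqrt_eq_rpow M]
  have e2 : Real.sqrt (A₂ * N ^ (3 / 2 : ℝ) * M ^ (3 / 4 + 2 * ε)) =
      Real.sqrt A₂ * N ^ (3 / 4 : ℝ) * M ^ (3 / 8 + ε) := by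
    rw [Real.sqrt_mul (by positivity), Real.sqrt_mul hA₂, Real.sqrt_eq_rpow (N ^ (3 / 2 : ℝ)),
      Real.sqrt_eq_rpow (M ^ (3 / 4 + 2 * ε)), ← Real.rpow_mul hN.le, ← Real.rpow_mul hM.le]
    have a1 : (3 / 2 : ℝ) * (1 / 2) = 3 / 4 := by norm_num
    have a2 : (3 / 4 + 2 * ε) * (1 / 2 : ℝ) = 3 / 8 + ε := by ring
    rw [a1, a2]
  rw [e1, e2]

/-- The trivial range `M ≤ 2N²`: `√(2M) √(2N) ≤ 4 N^{3/4} M^{3/8+ε}`. [folklore] -/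
theorem trivial_range_shape {M N ε : ℝ} (hM : 1 ≤ M) (hN : 1 ≤ N) (hMN : M ≤ 2 * N ^ 2) (hε : 0 ≤ ε) :
    Real.sqrt (2 * M) * Real.sqrt (2 * N) ≤ 4 * N ^ (3 / 4 : ℝ) * M ^ (3 / 8 + ε) := by
  have hM0 : 0 < M := by linarith
  have hN0 : 0 < N := by linarith
  rw [← Real.sqrt_mul (by positivity), show 2 * M * (2 * N) = 4 * (M * N) by ring,
    Real.sqrt_mul (by norm_num), show Real.sqrt 4 = 2 by
      rw [show (4 : ℝ) = 2 ^ 2 by norm_num, Real.sqrt_sq (by norm_num)],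
    Real.sqrt_eq_rpow, Real.mul_rpow hM0.le hN0.le]
  -- `M^{1/2} = M^{3/8} M^{1/8}`, `M^{1/8} ≤ (2N²)^{1/8} ≤ 2 N^{1/4}`
  have h1 : M ^ (1 / 2 : ℝ) = M ^ (3 / 8 : ℝ) * M ^ (1 / 8 : ℝ) := by
    rw [← Real.rpow_add hM0]; norm_num
  have h2 : M ^ (1 / 8 : ℝ) ≤ 2 * N ^ (1 / 4 : ℝ) := by
    calc M ^ (1 / 8 : ℝ) ≤ (2 * N ^ 2) ^ (1 / 8 : ℝ) := Real.rpow_le_rpow hM0.le hMN (by norm_num)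
      _ = (2 : ℝ) ^ (1 / 8 : ℝ) * N ^ (1 / 4 : ℝ) := by
          rw [Real.mul_rpow (by norm_num) (by positivity), show (N ^ 2 : ℝ) = N ^ (2 : ℝ) by norm_cast,
            ← Real.rpow_mul hN0.le]
          norm_num
      _ ≤ 2 * N ^ (1 / 4 : ℝ) := by
          refine mul_le_mul_of_nonneg_right ?_ (by positivity)
          calc (2 : ℝ) ^ (1 / 8 : ℝ) ≤ (2 : ℝ) ^ (1 : ℝ) := Real.rpow_le_rpow_of_exponent_le (by norm_num) (by norm_num)
            _ = 2 := Real.rpow_one _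
  have h3 : M ^ (3 / 8 : ℝ) ≤ M ^ (3 / 8 + ε) := Real.rpow_le_rpow_of_exponent_le hM (by linarith)
  have h4 : N ^ (1 / 4 : ℝ) * N ^ (1 / 2 : ℝ) = N ^ (3 / 4 : ℝ) := by
    rw [← Real.rpow_add hN0]; norm_num
  calc 2 * (M ^ (1 / 2 : ℝ) * N ^ (1 / 2 : ℝ)) = 2 * (M ^ (3 / 8 : ℝ) * M ^ (1 / 8 : ℝ) * N ^ (1 / 2 : ℝ)) := by
        rw [h1]
    _ ≤ 2 * (M ^ (3 / 8 + ε) * (2 * N ^ (1 / 4 : ℝ)) * N ^ (1 / 2 : ℝ)) := by gcongr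
    _ = 4 * (N ^ (1 / 4 : ℝ) * N ^ (1 / 2 : ℝ)) * M ^ (3 / 8 + ε) := by ring
    _ = 4 * N ^ (3 / 4 : ℝ) * M ^ (3 / 8 + ε) := by rw [h4]

/-! ### Proposition 2 from Proposition 4 -/

/-- **DFI Proposition 2 from Proposition 4** (§5 of the paper; see the module docstring for the
outline and the two points made explicit).
[cite: DukeFriedlanderIwaniec1995, Proposition 2 p. 426 (10); proof §5 pp. 432–433] -/
theorem _root_.Literature.NumberTheory.Sieve.dukeFriedlanderIwaniec1995_proposition2_of_proposition4
    (H4 : dukeFriedlanderIwaniec1995_proposition4) : dukeFriedlanderIwaniec1995_proposition2 := by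
  intro a b c hD ε hε C₂ hC₂
  -- constants
  obtain ⟨Bρ, hBρ1, hBρ⟩ := exists_rho_primePow_le_quad hD
  obtain ⟨Cd, hCd0, hCd⟩ := exists_norm_diag_weight_le hD
  obtain ⟨Ko, hKo0, hKo⟩ := exists_norm_offdiag_weight_le H4 hD (C₁ := 6) (C₂ := 2 * C₂)
    (by norm_num) (by positivity)
  obtain ⟨B, hB1, hB⟩ := exists_smoothTransition_bound
  set η : ℝ := ε / 4 with hη
  have hη0 : 0 < η := by positivity
  obtain ⟨Cτ, hCτ1, hτ⟩ := exists_card_divisors_le_mul_rpow hη0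
  set T₁ : ℝ := Cτ * C₂ ^ η with hT₁
  set CΦ : ℝ := (3 : ℝ) ^ η / η * (1 + 2 * C₂ ^ η / η) with hCΦ
  set A₁ : ℝ := 6 * Cd + 3888 * B * Ko with hA₁
  set A₂ : ℝ := 3888 * B * Ko * T₁ ^ (3 / 2 : ℝ) * CΦ with hA₂
  have hT₁0 : 0 < T₁ := by positivity
  have hCΦ0 : 0 < CΦ := by positivity
  have hA₁0 : 0 < A₁ := by positivity
  have hA₂0 : 0 < A₂ := by positivity
  clear_value T₁ CΦ A₁ A₂
  refine ⟨Real.sqrt A₁ + Real.sqrt A₂ + 4 * Bρ, ?_⟩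
  intro h hh M N hM hN hhMN α β hα hβ
  set f : ℤ[X] := quad a b c with hf
  have hM0 : 0 < M := by linarith
  have hN0 : 0 < N := by linarith
  set L : ℝ := l2Norm β N with hL
  set Aρ : ℝ := normAlphaRho f α M with hAρ
  have hL0 : 0 ≤ L := Real.sqrt_nonneg _
  have hAρ0 : 0 ≤ Aρ := Real.sqrt_nonneg _
  have hshape0 : 0 ≤ M ^ (1 / 2 : ℝ) + N ^ (3 / 4 : ℝ) * M ^ (3 / 8 + ε) := by positivity
  have hρβ : ∀ n : ℕ, β n ≠ 0 → (polyRootCountMod ![f] n : ℝ) ≤ Bρ := by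
    intro n hn
    have := hBρ n 1 (hβ n hn).2.2
    rwa [pow_one] at this
  have hx0 : 0 ≤ M ^ (1 / 2 : ℝ) := by positivity
  have hy0 : 0 ≤ N ^ (3 / 4 : ℝ) * M ^ (3 / 8 + ε) := by positivity
  have hBρ0 : 0 ≤ Bρ := by linarith
  have hK0 : 0 ≤ Real.sqrt A₁ + Real.sqrt A₂ + 4 * Bρ := by
    linarith [Real.sqrt_nonneg A₁, Real.sqrt_nonneg A₂]
  rcases le_or_gt M (2 * N ^ 2) with hMN | hMN
  · -- the trivial range
    have h1 := norm_bilinearForm_le_trivial f h α β hM0.le hN0.le hBρ0 hρβ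
    have h2 := trivial_range_shape hM hN hMN hε.le
    have a1 : 4 * Bρ ≤ Real.sqrt A₁ + Real.sqrt A₂ + 4 * Bρ := by
      linarith [Real.sqrt_nonneg A₁, Real.sqrt_nonneg A₂]
    have a2 : N ^ (3 / 4 : ℝ) * M ^ (3 / 8 + ε) ≤ M ^ (1 / 2 : ℝ) + N ^ (3 / 4 : ℝ) * M ^ (3 / 8 + ε) := by
      linarith
    calc ‖bilinearForm f h α β M N‖ ≤ Bρ * Real.sqrt (2 * M) * Real.sqrt (2 * N) * Aρ * L := h1
      _ = Bρ * (Real.sqrt (2 * M) * Real.sqrt (2 * N)) * Aρ * L := by ring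
      _ ≤ Bρ * (4 * N ^ (3 / 4 : ℝ) * M ^ (3 / 8 + ε)) * Aρ * L :=
          mul_le_mul_of_nonneg_right (mul_le_mul_of_nonneg_right
            (mul_le_mul_of_nonneg_left h2 hBρ0) hAρ0) hL0
      _ = (4 * Bρ) * Aρ * L * (N ^ (3 / 4 : ℝ) * M ^ (3 / 8 + ε)) := by ring
      _ ≤ (Real.sqrt A₁ + Real.sqrt A₂ + 4 * Bρ) * Aρ * L * (M ^ (1 / 2 : ℝ) + N ^ (3 / 4 : ℝ) * M ^ (3 / 8 + ε)) :=
          mul_le_mul (mul_le_mul_of_nonneg_right (mul_le_mul_of_nonneg_right a1 hAρ0) hL0) a2 hy0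
            (mul_nonneg (mul_nonneg hK0 hAρ0) hL0)
  · -- the range `2N² < M`
    have hN2 : (1 : ℝ) ≤ N ^ 2 := one_le_pow₀ hN
    have hM2 : 2 ≤ M := by linarith
    have hNM : N ≤ M := by
      have : N ≤ N ^ 2 := by nlinarith [hN]
      linarith
    set Sn := Icc 1 ⌊2 * N⌋₊ with hSn
    set U := Icc 1 ⌊3 * M⌋₊ with hU
    set V : ℕ → ℕ → ℝ := fun n₁ n₂ => ‖∑ m ∈ U.filter (fun m => Nat.Coprime m n₁ ∧ Nat.Coprime m n₂),
      (coverWeight M m : ℂ) * fibrePairSum f h m n₁ n₂‖ with hV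
    -- the master inequality
    have hmaster : ‖bilinearForm f h α β M N‖ ^ 2 ≤ Aρ ^ 2 *
        ∑ n₁ ∈ Sn, ∑ n₂ ∈ Sn, ‖β n₁‖ * ‖β n₂‖ * V n₁ n₂ := by
      have := norm_bilinearForm_sq_le_master f h α β M N U (coverWeight M)
        (fun m hm _ => by
          rw [hU, Finset.mem_Icc]; rw [Finset.mem_Icc] at hm
          exact ⟨hm.1, hm.2.trans (Nat.floor_le_floor (by linarith))⟩)
        (fun m _ => Finset.sum_nonneg fun k _ => (pieceWeight_mem hM0 k _).1)
        (fun m _ hαm => by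
          obtain ⟨h1, h2⟩ := hα m hαm
          exact one_le_sum_pieceWeight hM0 h1 h2)
      simpa only [hV] using this
    -- the pair bounds
    set X₃ : ℝ := 3 * N ^ (1 / 2 : ℝ) * M ^ (3 / 4 : ℝ) * Real.log (3 * M) with hX₃
    have hlog3 : 0 ≤ Real.log (3 * M) := Real.log_nonneg (by linarith)
    have hX₃0 : 0 ≤ X₃ := by positivity
    set E₀ : ℝ := 648 * B * Ko * (T₁ ^ (3 / 2 : ℝ) * M ^ (9 * η / 2)) * X₃ with hE₀
    set E₁ : ℝ := 1944 * B * Ko * M / N with hE₁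
    have hE₀0 : 0 ≤ E₀ := by positivity
    have hE₁0 : 0 ≤ E₁ := by positivity
    set w : ℕ → ℝ := fun n => (Nat.gcd h n : ℝ) ^ (1 / 4 : ℝ) with hw
    have hw0 : ∀ n, 0 ≤ w n := fun n => by positivity
    have hdiag : ∀ n ∈ Sn, ‖β n‖ ≠ 0 → V n n ≤ 6 * Cd * M := by
      intro n _ hn
      have hpr : n.Prime := (hβ n (fun h0 => hn (by rw [h0, norm_zero]))).2.2
      exact norm_cover_diag_le hCd hM2 h hpr
    have hoff : ∀ n₁ ∈ Sn, ∀ n₂ ∈ Sn, ‖β n₁‖ ≠ 0 → ‖β n₂‖ ≠ 0 → n₁ ≠ n₂ →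
        V n₁ n₂ ≤ E₀ * w n₁ * w n₂ + E₁ := by
      intro n₁ _ n₂ _ hb₁ hb₂ hne
      obtain ⟨hn₁, hn₁', hp₁⟩ := hβ n₁ (fun h0 => hb₁ (by rw [h0, norm_zero]))
      obtain ⟨hn₂, hn₂', hp₂⟩ := hβ n₂ (fun h0 => hb₂ (by rw [h0, norm_zero]))
      have hV' := norm_cover_offdiag_le (f := f) hB1 hB hKo hKo0.le hC₂ hN hMN hh hhMN hp₁ hp₂ hne
        ⟨hn₁, hn₁'⟩ ⟨hn₂, hn₂'⟩
      refine hV'.trans ?_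
      -- `τ(h''d)^{3/2} ≤ T₁^{3/2} M^{9η/2}`
      obtain ⟨ht₁, ht₂, htN⟩ := natAbs_sub_lt_of_mem hn₁ hn₁' hn₂ hn₂'
      have hprod0 : h * Int.natAbs ((n₂ : ℤ) - n₁) * (n₁ * n₂) ≠ 0 := by
        refine Nat.mul_ne_zero (Nat.mul_ne_zero (by omega) ?_) (Nat.mul_ne_zero hp₁.ne_zero hp₂.ne_zero)
        rw [Ne, Int.natAbs_eq_zero, sub_eq_zero]; exact_mod_cast hne.symm
      have hprod : ((h * Int.natAbs ((n₂ : ℤ) - n₁) * (n₁ * n₂) : ℕ) : ℝ) ≤ C₂ * M ^ 3 := by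
        push_cast
        have e1 : (h : ℝ) * (Int.natAbs ((n₂ : ℤ) - n₁) : ℕ) ≤ C₂ * M * N ^ 2 := by
          calc (h : ℝ) * (Int.natAbs ((n₂ : ℤ) - n₁) : ℕ) ≤ (C₂ * M * N) * N :=
                mul_le_mul hhMN htN (Nat.cast_nonneg _) (by positivity)
            _ = C₂ * M * N ^ 2 := by ring
        have e2 : (n₁ : ℝ) * n₂ ≤ 4 * N ^ 2 := by
          calc (n₁ : ℝ) * n₂ ≤ (2 * N) * (2 * N) := mul_le_mul hn₁' hn₂' (Nat.cast_nonneg _) (by positivity)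
            _ = 4 * N ^ 2 := by ring
        have e3 : N ^ 2 * N ^ 2 ≤ M ^ 2 / 4 := by
          have a : N ^ 2 ≤ M / 2 := by linarith
          calc N ^ 2 * N ^ 2 ≤ (M / 2) * (M / 2) := mul_le_mul a a (by positivity) (by positivity)
            _ = M ^ 2 / 4 := by ring
        calc (h : ℝ) * (Int.natAbs ((n₂ : ℤ) - n₁) : ℕ) * ((n₁ : ℝ) * n₂) ≤ (C₂ * M * N ^ 2) * (4 * N ^ 2) :=
              mul_le_mul e1 e2 (by positivity) (by positivity)
          _ = 4 * C₂ * M * (N ^ 2 * N ^ 2) := by ring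
          _ ≤ 4 * C₂ * M * (M ^ 2 / 4) := by gcongr
          _ = C₂ * M ^ 3 := by ring
      have hτle : (((Nat.divisors (h * Int.natAbs ((n₂ : ℤ) - n₁) * (n₁ * n₂))).card : ℝ)) ^ (3 / 2 : ℝ) ≤
          T₁ ^ (3 / 2 : ℝ) * M ^ (9 * η / 2) := by
        have h1 := hτ _ hprod0
        have h2 : (((Nat.divisors (h * Int.natAbs ((n₂ : ℤ) - n₁) * (n₁ * n₂))).card : ℝ)) ≤ T₁ * M ^ (3 * η) := by
          refine h1.trans ?_
          calc Cτ * ((h * Int.natAbs ((n₂ : ℤ) - n₁) * (n₁ * n₂) : ℕ) : ℝ) ^ η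
              ≤ Cτ * (C₂ * M ^ 3) ^ η := by gcongr
            _ = T₁ * M ^ (3 * η) := by
                rw [hT₁, Real.mul_rpow hC₂.le (by positivity), show (M ^ 3 : ℝ) = M ^ (3 : ℝ) by norm_cast,
                  ← Real.rpow_mul hM0.le]; ring
        calc (((Nat.divisors (h * Int.natAbs ((n₂ : ℤ) - n₁) * (n₁ * n₂))).card : ℝ)) ^ (3 / 2 : ℝ)
            ≤ (T₁ * M ^ (3 * η)) ^ (3 / 2 : ℝ) := Real.rpow_le_rpow (Nat.cast_nonneg _) h2 (by norm_num)
          _ = T₁ ^ (3 / 2 : ℝ) * M ^ (9 * η / 2) := by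
              rw [Real.mul_rpow hT₁0.le (by positivity), ← Real.rpow_mul hM0.le]; ring_nf
      have hww : 0 ≤ w n₁ * w n₂ := mul_nonneg (hw0 _) (hw0 _)
      calc 648 * B * Ko * ((((Nat.divisors (h * Int.natAbs ((n₂ : ℤ) - n₁) * (n₁ * n₂))).card : ℝ) ^ (3 / 2 : ℝ)) *
            ((Nat.gcd h n₁ : ℝ) ^ (1 / 4 : ℝ) * (Nat.gcd h n₂ : ℝ) ^ (1 / 4 : ℝ)) * X₃ + 3 * M / N)
          = 648 * B * Ko * ((((Nat.divisors (h * Int.natAbs ((n₂ : ℤ) - n₁) * (n₁ * n₂))).card : ℝ) ^ (3 / 2 : ℝ))) *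
              (w n₁ * w n₂) * X₃ + 1944 * B * Ko * M / N := by simp only [hw]; ring
        _ ≤ 648 * B * Ko * (T₁ ^ (3 / 2 : ℝ) * M ^ (9 * η / 2)) * (w n₁ * w n₂) * X₃ + 1944 * B * Ko * M / N := by
            gcongr
        _ = E₀ * w n₁ * w n₂ + E₁ := by rw [hE₀, hE₁]; ring
    have hpairs := sum_sum_pairs_le Sn (fun n => ‖β n‖) w V (fun n => norm_nonneg _) hw0 hE₀0 hE₁0 hdiag hoff
    -- the three sums in `n`
    have hL2 : ∑ n ∈ Sn, ‖β n‖ ^ 2 = L ^ 2 := by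
      rw [hL, l2Norm, Real.sq_sqrt (Finset.sum_nonneg fun _ _ => by positivity)]
    have hsum1 : (∑ n ∈ Sn, ‖β n‖) ^ 2 ≤ 2 * N * L ^ 2 := by
      refine (sq_sum_le_card_mul_sum_sq Sn _).trans ?_
      rw [hL2]
      refine mul_le_mul_of_nonneg_right ?_ (sq_nonneg _)
      rw [hSn, Nat.card_Icc]; simp only [add_tsub_cancel_right]; exact Nat.floor_le (by positivity)
    have hsumw : (∑ n ∈ Sn, ‖β n‖ * w n) ^ 2 ≤ 2 * N * ((1 + 2 * C₂ ^ η / η) * M ^ (2 * η)) * L ^ 2 := by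
      refine (sq_sum_mul_le Sn _ _).trans ?_
      rw [hL2]
      refine mul_le_mul_of_nonneg_right ?_ (sq_nonneg _)
      -- `∑_{β ≠ 0} w² ≤ ∑_{primes} √(h,n) ≤ 2N + 2√(2N) log h`
      have hsub : Sn.filter (fun n => ‖β n‖ ≠ 0) ⊆ Sn.filter Nat.Prime := by
        intro n hn
        rw [Finset.mem_filter] at hn ⊢
        exact ⟨hn.1, (hβ n (fun h0 => hn.2 (by rw [h0, norm_zero]))).2.2⟩
      have hw2 : ∀ n, w n ^ 2 = Real.sqrt (Nat.gcd h n : ℝ) := by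
        intro n
        rw [hw, ← Real.rpow_natCast, ← Real.rpow_mul (Nat.cast_nonneg _), Real.sqrt_eq_rpow]
        norm_num
      calc ∑ n ∈ Sn.filter (fun n => ‖β n‖ ≠ 0), w n ^ 2
          ≤ ∑ n ∈ Sn.filter Nat.Prime, w n ^ 2 :=
            Finset.sum_le_sum_of_subset_of_nonneg hsub fun _ _ _ => sq_nonneg _
        _ = ∑ n ∈ Sn.filter Nat.Prime, Real.sqrt (Nat.gcd h n : ℝ) := Finset.sum_congr rfl fun n _ => hw2 n
        _ ≤ 2 * N + 2 * Real.sqrt (2 * N) * Real.log h := sum_sqrt_gcd_primes_le hh hN0.le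
        _ ≤ 2 * N + 2 * (2 * N) * (C₂ ^ η / η * M ^ (2 * η)) := by
            have hsq : Real.sqrt (2 * N) ≤ 2 * N := by
              rw [Real.sqrt_le_left (by positivity)]
              calc 2 * N = 2 * N * 1 := by ring
                _ ≤ 2 * N * (2 * N) := mul_le_mul_of_nonneg_left (by linarith) (by positivity)
                _ = (2 * N) ^ 2 := by ring
            have hlogh : Real.log h ≤ C₂ ^ η / η * M ^ (2 * η) := by
              have hh0 : (0 : ℝ) < h := by exact_mod_cast hh
              calc Real.log h ≤ Real.log (C₂ * M * M) := by
                    refine Real.log_le_log hh0 (hhMN.trans ?_)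
                    exact mul_le_mul_of_nonneg_left hNM (by positivity)
                _ ≤ (C₂ * M * M) ^ η / η := Real.log_le_rpow_div (by positivity) hη0
                _ = C₂ ^ η / η * M ^ (2 * η) := by
                    rw [mul_assoc, Real.mul_rpow hC₂.le (by positivity), show M * M = M ^ (2 : ℝ) by
                      rw [← sq]; norm_cast, ← Real.rpow_mul hM0.le]; ring
            have hlogh0 : 0 ≤ Real.log h := Real.log_natCast_nonneg h
            have step : Real.sqrt (2 * N) * Real.log h ≤ (2 * N) * (C₂ ^ η / η * M ^ (2 * η)) :=
              mul_le_mul hsq hlogh hlogh0 (by positivity)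
            linarith
        _ ≤ 2 * N * ((1 + 2 * C₂ ^ η / η) * M ^ (2 * η)) := by
            have h1 : 1 ≤ M ^ (2 * η) := Real.one_le_rpow hM (by positivity)
            have h2 : 2 * N ≤ 2 * N * M ^ (2 * η) := le_mul_of_one_le_right (by positivity) h1
            calc 2 * N + 2 * (2 * N) * (C₂ ^ η / η * M ^ (2 * η))
                = 2 * N + 4 * N * (C₂ ^ η / η) * M ^ (2 * η) := by ring
              _ ≤ 2 * N * M ^ (2 * η) + 4 * N * (C₂ ^ η / η) * M ^ (2 * η) := by linarith
              _ = 2 * N * ((1 + 2 * C₂ ^ η / η) * M ^ (2 * η)) := by ring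
    -- assembling `Σ ≤ (A₁ M + A₂ N^{3/2} M^{3/4+2ε}) L²`
    have hSig : ∑ n₁ ∈ Sn, ∑ n₂ ∈ Sn, ‖β n₁‖ * ‖β n₂‖ * V n₁ n₂ ≤
        (A₁ * M + A₂ * N ^ (3 / 2 : ℝ) * M ^ (3 / 4 + 2 * ε)) * L ^ 2 := by
      refine hpairs.trans ?_
      rw [hL2]
      have t1 : 6 * Cd * M * L ^ 2 + E₁ * (2 * N * L ^ 2) = A₁ * M * L ^ 2 := by
        rw [hA₁, hE₁]; field_simp; ring
      have t2 : E₀ * (2 * N * ((1 + 2 * C₂ ^ η / η) * M ^ (2 * η))) ≤ A₂ * N ^ (3 / 2 : ℝ) * M ^ (3 / 4 + 2 * ε) := by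
        -- `log(3M) ≤ 3^η/η M^η` and `M^{9η/2} M^{3/4} M^η M^{2η} ≤ M^{3/4 + 2ε}`
        have hl : Real.log (3 * M) ≤ (3 : ℝ) ^ η / η * M ^ η := by
          calc Real.log (3 * M) ≤ (3 * M) ^ η / η := Real.log_le_rpow_div (by positivity) hη0
            _ = (3 : ℝ) ^ η / η * M ^ η := by rw [Real.mul_rpow (by norm_num) hM0.le]; ring
        have hexp : M ^ (9 * η / 2) * M ^ (3 / 4 : ℝ) * M ^ η * M ^ (2 * η) ≤ M ^ (3 / 4 + 2 * ε) := by
          rw [← Real.rpow_add hM0, ← Real.rpow_add hM0, ← Real.rpow_add hM0]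
          refine Real.rpow_le_rpow_of_exponent_le hM ?_
          rw [hη]; linarith
        have hN32 : N * N ^ (1 / 2 : ℝ) = N ^ (3 / 2 : ℝ) := by
          nth_rw 1 [← Real.rpow_one N]
          rw [← Real.rpow_add hN0]; norm_num
        calc E₀ * (2 * N * ((1 + 2 * C₂ ^ η / η) * M ^ (2 * η)))
            = 3888 * B * Ko * T₁ ^ (3 / 2 : ℝ) * (1 + 2 * C₂ ^ η / η) * (N * N ^ (1 / 2 : ℝ)) *
                (M ^ (9 * η / 2) * M ^ (3 / 4 : ℝ) * M ^ (2 * η)) * Real.log (3 * M) := by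
              rw [hE₀, hX₃]; ring
          _ ≤ 3888 * B * Ko * T₁ ^ (3 / 2 : ℝ) * (1 + 2 * C₂ ^ η / η) * (N * N ^ (1 / 2 : ℝ)) *
                (M ^ (9 * η / 2) * M ^ (3 / 4 : ℝ) * M ^ (2 * η)) * ((3 : ℝ) ^ η / η * M ^ η) := by
              gcongr
          _ = 3888 * B * Ko * T₁ ^ (3 / 2 : ℝ) * ((3 : ℝ) ^ η / η * (1 + 2 * C₂ ^ η / η)) * (N * N ^ (1 / 2 : ℝ)) *
                (M ^ (9 * η / 2) * M ^ (3 / 4 : ℝ) * M ^ η * M ^ (2 * η)) := by ring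
          _ ≤ 3888 * B * Ko * T₁ ^ (3 / 2 : ℝ) * ((3 : ℝ) ^ η / η * (1 + 2 * C₂ ^ η / η)) * (N * N ^ (1 / 2 : ℝ)) *
                M ^ (3 / 4 + 2 * ε) := by gcongr
          _ = A₂ * N ^ (3 / 2 : ℝ) * M ^ (3 / 4 + 2 * ε) := by rw [hA₂, hCΦ, hN32]
      have hD0 : 0 ≤ 6 * Cd * M := by positivity
      calc 6 * Cd * M * L ^ 2 + E₀ * (∑ n ∈ Sn, ‖β n‖ * w n) ^ 2 + E₁ * (∑ n ∈ Sn, ‖β n‖) ^ 2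
          ≤ 6 * Cd * M * L ^ 2 + E₀ * (2 * N * ((1 + 2 * C₂ ^ η / η) * M ^ (2 * η)) * L ^ 2) + E₁ * (2 * N * L ^ 2) := by
            gcongr
        _ = (6 * Cd * M * L ^ 2 + E₁ * (2 * N * L ^ 2)) + E₀ * (2 * N * ((1 + 2 * C₂ ^ η / η) * M ^ (2 * η))) * L ^ 2 := by
            ring
        _ ≤ A₁ * M * L ^ 2 + (A₂ * N ^ (3 / 2 : ℝ) * M ^ (3 / 4 + 2 * ε)) * L ^ 2 := by
            rw [t1]
            exact add_le_add le_rfl (mul_le_mul_of_nonneg_right t2 (sq_nonneg _))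
        _ = (A₁ * M + A₂ * N ^ (3 / 2 : ℝ) * M ^ (3 / 4 + 2 * ε)) * L ^ 2 := by ring
    -- take square roots
    set Q : ℝ := A₁ * M + A₂ * N ^ (3 / 2 : ℝ) * M ^ (3 / 4 + 2 * ε) with hQ
    have hQ0 : 0 ≤ Q := by positivity
    have hsq : ‖bilinearForm f h α β M N‖ ^ 2 ≤ (Aρ * L * Real.sqrt Q) ^ 2 := by
      calc ‖bilinearForm f h α β M N‖ ^ 2 ≤ Aρ ^ 2 * ∑ n₁ ∈ Sn, ∑ n₂ ∈ Sn, ‖β n₁‖ * ‖β n₂‖ * V n₁ n₂ := hmaster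
        _ ≤ Aρ ^ 2 * (Q * L ^ 2) := mul_le_mul_of_nonneg_left hSig (sq_nonneg _)
        _ = (Aρ * L * Real.sqrt Q) ^ 2 := by rw [mul_pow, mul_pow, Real.sq_sqrt hQ0]; ring
    have hB' : ‖bilinearForm f h α β M N‖ ≤ Aρ * L * Real.sqrt Q :=
      (pow_le_pow_iff_left₀ (norm_nonneg _) (by positivity) two_ne_zero).1 hsq
    have hroot : Real.sqrt Q ≤ Real.sqrt A₁ * M ^ (1 / 2 : ℝ) + Real.sqrt A₂ * N ^ (3 / 4 : ℝ) * M ^ (3 / 8 + ε) :=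
      sqrt_main_le hA₁0.le hA₂0.le hM0 hN0
    have hfin : Real.sqrt A₁ * M ^ (1 / 2 : ℝ) + Real.sqrt A₂ * N ^ (3 / 4 : ℝ) * M ^ (3 / 8 + ε) ≤
        (Real.sqrt A₁ + Real.sqrt A₂ + 4 * Bρ) * (M ^ (1 / 2 : ℝ) + N ^ (3 / 4 : ℝ) * M ^ (3 / 8 + ε)) := by
      have h1 : 0 ≤ Real.sqrt A₁ := Real.sqrt_nonneg _
      have h2 : 0 ≤ Real.sqrt A₂ := Real.sqrt_nonneg _
      have key : (Real.sqrt A₁ + Real.sqrt A₂ + 4 * Bρ) * (M ^ (1 / 2 : ℝ) + N ^ (3 / 4 : ℝ) * M ^ (3 / 8 + ε)) =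
          (Real.sqrt A₁ * M ^ (1 / 2 : ℝ) + Real.sqrt A₂ * N ^ (3 / 4 : ℝ) * M ^ (3 / 8 + ε)) +
          (Real.sqrt A₁ * (N ^ (3 / 4 : ℝ) * M ^ (3 / 8 + ε)) + Real.sqrt A₂ * M ^ (1 / 2 : ℝ) +
            4 * Bρ * (M ^ (1 / 2 : ℝ) + N ^ (3 / 4 : ℝ) * M ^ (3 / 8 + ε))) := by ring
      rw [key]
      have : 0 ≤ Real.sqrt A₁ * (N ^ (3 / 4 : ℝ) * M ^ (3 / 8 + ε)) + Real.sqrt A₂ * M ^ (1 / 2 : ℝ) +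
          4 * Bρ * (M ^ (1 / 2 : ℝ) + N ^ (3 / 4 : ℝ) * M ^ (3 / 8 + ε)) := by positivity
      linarith
    calc ‖bilinearForm f h α β M N‖ ≤ Aρ * L * Real.sqrt Q := hB'
      _ ≤ Aρ * L * (Real.sqrt A₁ * M ^ (1 / 2 : ℝ) + Real.sqrt A₂ * N ^ (3 / 4 : ℝ) * M ^ (3 / 8 + ε)) :=
          mul_le_mul_of_nonneg_left hroot (mul_nonneg hAρ0 hL0)
      _ ≤ Aρ * L * ((Real.sqrt A₁ + Real.sqrt A₂ + 4 * Bρ) * (M ^ (1 / 2 : ℝ) + N ^ (3 / 4 : ℝ) * M ^ (3 / 8 + ε))) :=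
          mul_le_mul_of_nonneg_left hfin (mul_nonneg hAρ0 hL0)
      _ = (Real.sqrt A₁ + Real.sqrt A₂ + 4 * Bρ) * Aρ * L * (M ^ (1 / 2 : ℝ) + N ^ (3 / 4 : ℝ) * M ^ (3 / 8 + ε)) := by
          ring

end DFI1995

end Literature.NumberTheory.Sieve
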